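import Summits.QuantumFields.BalabanUV.Beta.GaugeMultiplierBlockMean
import Summits.QuantumFields.BalabanUV.Beta.AxialDressingRootedBmDress
import Summits.QuantumFields.BalabanUV.Beta.D1BFx.FineHessianWardRelative

/-!
# `BalabanUV.Beta.D1BFx.CoProjBmDivergence` — the fine codifferential of a BLOCK-MEAN-ROOTED (`Πᵀ_bm`) dressed bond family is the
# BLOCK AVERAGE of the undressed one, at every site and for every in-block root; the Bm twin of `CoProjDivergence` and of the
# letters-ENDs of `FineHessianWardRelative` (β sub-cell, row **D1**, road FP N3-fine, leaf prover leaf-01 gen 5)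

HONEST FRAMING (cell charter, verbatim): «discharging BetaPertH makes Balaban's UV stability UNCONDITIONAL — a real
constructive-QFT result; it is NOT the continuum limit and NOT the Clay problem.»  DERIVED cell leaf (pub-balaban β sub-cell,
D1 formalisation swarm); no statement of Bałaban's papers is typed here, no `[cite:]` tag, no `Prop` fact.  NOT `BetaPertH`;
NOT continuum; NOT Clay.

## Why (journal NOTE «N3-FINE-DRESSING-MISMATCH», leaf-01-g5)

`CoProjDivergence.divV_coProj` computed the pure-gauge vertex of a CORNER-COMB (`AxialDressing.coProj`) dressed stencil: the block SUM
of the undressed vertex, supported on BASE POINTS.  The row-D1 literal of record dresses its kernels by the BLOCK-MEAN-NORMALISED rooted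
projector instead (`AxialDressingRooted.coDressKBmAt ρ N K = Πᵀ_bm ∘ K ∘ Π_bm`, bond slots by `coProjBmAtK ρ N`; every finite-`j` Ward /
`RelInv` fact in tree — `SpineRootedBmNWardRelInv.relInv_coDressKBmAt_KInvStep_bhKStepAt_all`, `WardLocusRecursive.hSd_SrecAt` — is about
this dressing).  This file supplies the Bm side of the fine Ward bookkeeping:

* §2 `codiff₁_coProjBmAt` — for `1 ≤ N`, an in-block root `toSite r` and ANY real bond family `g`,
  `codiff₁ (coProjBmAt (toSite r) N g) p = (N^{d+1})⁻¹ · Σ_{b ∈ box} codiff₁ g (N•blk N p + b)` at EVERY site `p`: the block AVERAGE, no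
  base-point condition, independent of the root.  It is the window-matrix transpose of an2's `BorderedHessian.axProjBmAt_dz`
  (`Π_bm (dz f) = dz (blockMeanAt N f)`), assembled from an2's `codiff₁_rowBm` / `blockMeanAt_ind` and the window bookkeeping of §1
  (`window_of_pmBm_ne_zero`).
* §3 `divV_coProjBmAtK` / `divW_coProjBmAtK_fst` — the `MKer` statements: `KernelWard.divV (coProjBmAtK (toSite r) N S) u
  = (N^{d+1})⁻¹ • Σ_{b ∈ box} KernelWard.divV S (N•blk N u + b)`.
* §4 `divV_coProjBmAtK_eq_conjV` — (W1′) for the dressed stencil at every fine site from the block-stencil Ward law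
  `cH • Σ_{v∈box} divV S (N•y+v) = conjV 𝕄 (Xc y)` with the BLOCK-CONSTANT generator `((N^{d+1})⁻¹cH⁻¹) • Xc (blk N u)`; and the Bm twins
  `divFree_fineHessA_coProjBmAtK_of_letters` / `hasSum_row_fineHessA_coProjBmAtK_of_letters` of the letters-ENDs of
  `FineHessianWardRelative` (`d + 1 = 4`, `Fib 3`): first-bond transversality and the Ward rows `hrow` of
  `fineHessA A (coProjBmAtK (toSite r) n S) Wf` from {`RelInv A 𝕄 E`, block-stencil Ward law, (W2♮) with that generator}.

HONEST: finite algebra (`Finset` sums, `tsum` only through the imported sockets); 0 `sorry`, 0 `[cite:]`, 0 `def … : Prop`; it does not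
choose the road's dressing (owner / leads' (R45) business) and instantiates no binder of the β-function wall by itself — 0/4 row-D1 binders
move.  NOT D1, NOT `BetaPertH`, NOT continuum, NOT Clay.
-/

noncomputable section

namespace Summit.QuantumFields.BalabanUV.Beta.D1BFx.CoProjBmDivergence

open Finset
open scoped BigOperators
open Literature.MathematicalPhysics.QuantumFieldTheory.Balaban1983to89
open Literature.MathematicalPhysics.QuantumFieldTheory.Balaban1983to89.Beta
open AffineAveraging (Form0 Form1 box toSite codiff₁ dz)
open AveragingContours (blk blk_block blk_add_off off off_mem_box)
open AxialProjector (toSite_injective zsmul_blk_le lt_zsmul_blk_add)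
open Summit.QuantumFields.BalabanUV.Beta.AxialDressingRooted (cube mem_cube pmBm window_of_pmBm_ne_zero coProjBmAt coProjBmAt_apply
  coProjBmAtK coProjBmAtK_eval)
open Summit.QuantumFields.BalabanUV.Beta.AxialProjectorBlockMean (blockMeanAt)
open Summit.QuantumFields.BalabanUV.Beta.BorderedHessian (rowBm rowBm_apply ind codiff₁_rowBm blockMeanAt_ind)

variable {d : ℕ}

/-! ## §1 Window bookkeeping -/

/-- [folklore] The offset of an in-block point: `off N (N•y + b) = b` for `b ∈ box`. -/
theorem off_block {N : ℕ} (hN : 1 ≤ N) (y : Fin (d + 1) → ℤ) {b : Fin (d + 1) → ℕ} (hb : b ∈ box (d + 1) N) :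
    off N ((N : ℤ) • y + toSite b) = b := by
  have h := blk_add_off hN ((N : ℤ) • y + toSite b)
  rw [blk_block y hb] at h
  exact toSite_injective (add_left_cancel h)

/-- [folklore] **WINDOW EXTENSION**: at a site `q` next to `p` (`|q − p|∞ ≤ 1`), the window sum defining `(Πᵀ_bm g)_α(q)` may be taken over the
LARGER window `p + cube (N+1)` — the matrix `pmBm` vanishes off the original window (`window_of_pmBm_ne_zero`). -/
theorem window_sum_eq {N : ℕ} (hN : 1 ≤ N) {r : Fin (d + 1) → ℕ} (hr : r ∈ box (d + 1) N) (g : Form1 (d + 1) ℝ) (α : Fin (d + 1))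
    {p q : Fin (d + 1) → ℤ} (hq : ∀ i, |q i - p i| ≤ 1) :
    ∑ v ∈ cube (d + 1) N, ∑ β : Fin (d + 1), pmBm (toSite r) N β (q + v) α q * g β (q + v)
      = ∑ v ∈ cube (d + 1) (N + 1), ∑ β : Fin (d + 1), pmBm (toSite r) N β (p + v) α q * g β (p + v) := by
  classical
  set F : (Fin (d + 1) → ℤ) → ℝ := fun w => ∑ β : Fin (d + 1), pmBm (toSite r) N β w α q * g β w with hF
  have e1 : ∑ v ∈ cube (d + 1) N, ∑ β : Fin (d + 1), pmBm (toSite r) N β (q + v) α q * g β (q + v)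
      = ∑ w ∈ (cube (d + 1) N).image (fun v => q + v), F w := by
    rw [Finset.sum_image (fun v _ v' _ h => add_left_cancel h)]
  have e2 : ∑ v ∈ cube (d + 1) (N + 1), ∑ β : Fin (d + 1), pmBm (toSite r) N β (p + v) α q * g β (p + v)
      = ∑ w ∈ (cube (d + 1) (N + 1)).image (fun v => p + v), F w := by
    rw [Finset.sum_image (fun v _ v' _ h => add_left_cancel h)]
  rw [e1, e2]
  symm
  refine (Finset.sum_subset ?_ ?_).symm
  · -- the small window is inside the large one
    intro w hw
    rw [Finset.mem_image] at hw ⊢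
    obtain ⟨v, hv, rfl⟩ := hw
    refine ⟨q - p + v, ?_, by abel⟩
    rw [mem_cube] at hv ⊢
    intro i
    have h1 := hv i
    have h2 := hq i
    simp only [Pi.add_apply, Pi.sub_apply]
    have := abs_add_le (q i - p i) (v i)
    push_cast
    linarith
  · -- off the small window the matrix vanishes
    intro w _ hw
    rw [hF]
    refine Finset.sum_eq_zero fun β _ => ?_
    by_cases h0 : pmBm (toSite r) N β w α q = 0
    · rw [h0, zero_mul]
    · exfalso
      apply hw
      rw [Finset.mem_image]
      exact ⟨w - q, window_of_pmBm_ne_zero hN hr h0, by abel⟩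

/-- [folklore] The in-block re-indexing `b ↦ N•blk p + b − p` of an indicator-restricted window sum (shift `e`):
`Σ_{v ∈ cube (N+1)} [blk (p+v+e) = blk p]·G (p+v) = Σ_{b ∈ box} G (N•blk p + b − e)` whenever `|e|∞ ≤ 1`. -/
theorem sum_cube_indicator_eq_sum_box {N : ℕ} (hN : 1 ≤ N) (G : (Fin (d + 1) → ℤ) → ℝ) (p e : Fin (d + 1) → ℤ)
    (he : ∀ i, |e i| ≤ 1) :
    ∑ v ∈ cube (d + 1) (N + 1), (if blk N p = blk N (p + v + e) then G (p + v) else 0)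
      = ∑ b ∈ box (d + 1) N, G ((N : ℤ) • blk N p + toSite b - e) := by
  classical
  rw [← Finset.sum_filter]
  symm
  refine Finset.sum_nbij' (fun b => (N : ℤ) • blk N p + toSite b - e - p) (fun v => off N (p + v + e)) ?_ ?_ ?_ ?_ ?_
  · intro b hb
    rw [Finset.mem_filter, mem_cube]
    refine ⟨fun i => ?_, ?_⟩
    · have hb' : b i < N := by
        simpa [AffineAveraging.box, Fintype.mem_piFinset, Finset.mem_range] using (Fintype.mem_piFinset.1 hb) i
      have a1 := zsmul_blk_le hN p i
      have a2 := lt_zsmul_blk_add hN p i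
      have h3 := abs_le.1 (he i)
      simp only [Pi.sub_apply, Pi.add_apply, toSite]
      rw [abs_le]; push_cast; constructor <;> omega
    · have e1 : p + ((N : ℤ) • blk N p + toSite b - e - p) + e = (N : ℤ) • blk N p + toSite b := by abel
      rw [e1, blk_block _ hb]
  · intro v hv
    rw [Finset.mem_filter] at hv
    exact off_mem_box hN _
  · intro b hb
    have e1 : p + ((N : ℤ) • blk N p + toSite b - e - p) + e = (N : ℤ) • blk N p + toSite b := by abel
    simp only [e1, off_block hN _ hb]
  · intro v hv
    rw [Finset.mem_filter] at hv
    have h := blk_add_off hN (p + v + e)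
    rw [← hv.2] at h
    show (N : ℤ) • blk N p + toSite (off N (p + v + e)) - e - p = v
    rw [h]
    abel
  · intro b hb
    congr 1
    abel

/-! ## §2 The fine codifferential of a `Πᵀ_bm`-dressed bond family: the BLOCK AVERAGE, at every site, root-free -/

/-- [folklore] **THE TRANSPOSE OF `axProjBmAt_dz`: THE FINE CODIFFERENTIAL OF A `Πᵀ_bm`-DRESSED REAL BOND FAMILY** (in-block root `r`,
`1 ≤ N`; no hypothesis on `g`): at EVERY site `p`,
`codiff₁ (coProjBmAt (toSite r) N g) p = (N^{d+1})⁻¹ · Σ_{b ∈ box} codiff₁ g (N•blk N p + b)` — the BLOCK AVERAGE of the undressed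
codifferential over the block of `p`.  Since `Π_bm (dz f) = dz (blockMeanAt N f)` (an2's `BorderedHessian.axProjBmAt_dz`: the block-mean
normalised projector kills exactly the gradients of block-mean-free functions and is root-independent on exact forms), its window-matrix
transpose sends the point codifferential to the block-mean one (an2's `codiff₁_rowBm` + `blockMeanAt_ind`, window bookkeeping §1). -/
theorem codiff₁_coProjBmAt {N : ℕ} (hN : 1 ≤ N) {r : Fin (d + 1) → ℕ} (hr : r ∈ box (d + 1) N) (g : Form1 (d + 1) ℝ)
    (p : Fin (d + 1) → ℤ) :
    codiff₁ (coProjBmAt (toSite r) N g) p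
      = (((N : ℝ) ^ (d + 1))⁻¹) * ∑ b ∈ box (d + 1) N, codiff₁ g ((N : ℤ) • blk N p + toSite b) := by
  -- step 1: both window sums over the common window `p + cube (N+1)`
  have hp0 : ∀ i, |p i - p i| ≤ 1 := fun i => by rw [sub_self, abs_zero]; exact zero_le_one
  have hpe : ∀ (α : Fin (d + 1)) (i : Fin (d + 1)), |(p - AffineAveraging.unitVec α) i - p i| ≤ 1 := fun α i => by
    simp only [Pi.sub_apply, AffineAveraging.unitVec, Pi.single_apply]
    split_ifs <;> simp
  have e1 : codiff₁ (coProjBmAt (toSite r) N g) p = ∑ v ∈ cube (d + 1) (N + 1), ∑ β : Fin (d + 1),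
      g β (p + v) * codiff₁ (rowBm (toSite r) N β (p + v)) p := by
    simp only [codiff₁, coProjBmAt_apply, rowBm_apply]
    rw [Finset.sum_congr rfl fun α _ => by rw [window_sum_eq hN hr g α (hpe α), window_sum_eq hN hr g α hp0]]
    calc ∑ α : Fin (d + 1), (∑ v ∈ cube (d + 1) (N + 1), ∑ β : Fin (d + 1),
            pmBm (toSite r) N β (p + v) α (p - AffineAveraging.unitVec α) * g β (p + v)
          - ∑ v ∈ cube (d + 1) (N + 1), ∑ β : Fin (d + 1), pmBm (toSite r) N β (p + v) α p * g β (p + v))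
        = ∑ α : Fin (d + 1), ∑ v ∈ cube (d + 1) (N + 1), ∑ β : Fin (d + 1),
            (pmBm (toSite r) N β (p + v) α (p - AffineAveraging.unitVec α) - pmBm (toSite r) N β (p + v) α p) * g β (p + v) := by
          refine Finset.sum_congr rfl fun α _ => ?_
          rw [← Finset.sum_sub_distrib]
          refine Finset.sum_congr rfl fun v _ => ?_
          rw [← Finset.sum_sub_distrib]
          refine Finset.sum_congr rfl fun β _ => ?_
          ring
      _ = ∑ v ∈ cube (d + 1) (N + 1), ∑ β : Fin (d + 1), ∑ α : Fin (d + 1),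
            (pmBm (toSite r) N β (p + v) α (p - AffineAveraging.unitVec α) - pmBm (toSite r) N β (p + v) α p) * g β (p + v) := by
          rw [Finset.sum_comm]
          exact Finset.sum_congr rfl fun v _ => Finset.sum_comm
      _ = _ := by
          refine Finset.sum_congr rfl fun v _ => Finset.sum_congr rfl fun β _ => ?_
          rw [Finset.mul_sum]
          refine Finset.sum_congr rfl fun α _ => ?_
          ring
  -- step 2: an2's `codiff₁_rowBm` + `blockMeanAt_ind`
  have e2 : ∀ (v : Fin (d + 1) → ℤ) (β : Fin (d + 1)), codiff₁ (rowBm (toSite r) N β (p + v)) p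
      = (if blk N p = blk N (p + v + AffineAveraging.unitVec β) then (((N : ℝ) ^ (d + 1))⁻¹) else 0)
        - (if blk N p = blk N (p + v) then (((N : ℝ) ^ (d + 1))⁻¹) else 0) := by
    intro v β
    rw [codiff₁_rowBm (toSite r) hN, dz, blockMeanAt_ind hN, blockMeanAt_ind hN]
  rw [e1]
  simp only [e2, mul_sub, Finset.sum_sub_distrib, mul_ite, mul_zero]
  -- step 3: re-index both indicator sums onto the block of `p`
  have e3 : ∀ β : Fin (d + 1), ∑ v ∈ cube (d + 1) (N + 1),
      (if blk N p = blk N (p + v + AffineAveraging.unitVec β) then g β (p + v) * (((N : ℝ) ^ (d + 1))⁻¹) else 0)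
      = ∑ b ∈ box (d + 1) N, g β ((N : ℤ) • blk N p + toSite b - AffineAveraging.unitVec β) * (((N : ℝ) ^ (d + 1))⁻¹) :=
    fun β => sum_cube_indicator_eq_sum_box hN (fun w => g β w * (((N : ℝ) ^ (d + 1))⁻¹)) p (AffineAveraging.unitVec β)
      (fun i => by simp only [AffineAveraging.unitVec, Pi.single_apply]; split_ifs <;> simp)
  have e4 : ∀ β : Fin (d + 1), ∑ v ∈ cube (d + 1) (N + 1),
      (if blk N p = blk N (p + v) then g β (p + v) * (((N : ℝ) ^ (d + 1))⁻¹) else 0)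
      = ∑ b ∈ box (d + 1) N, g β ((N : ℤ) • blk N p + toSite b) * (((N : ℝ) ^ (d + 1))⁻¹) := by
    intro β
    have h := sum_cube_indicator_eq_sum_box hN (fun w => g β w * (((N : ℝ) ^ (d + 1))⁻¹)) p 0
      (fun i => by simp)
    simpa only [add_zero, sub_zero] using h
  rw [Finset.sum_comm, Finset.sum_congr rfl fun β _ => e3 β, Finset.sum_comm (s := cube (d + 1) (N + 1)),
    Finset.sum_congr rfl fun β _ => e4 β]
  simp only [codiff₁, Finset.mul_sum, Finset.sum_sub_distrib, mul_sub]
  rw [Finset.sum_comm]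
  congr 1
  · refine Finset.sum_congr rfl fun b _ => Finset.sum_congr rfl fun β _ => ?_
    ring
  · rw [Finset.sum_comm]
    refine Finset.sum_congr rfl fun b _ => Finset.sum_congr rfl fun β _ => ?_
    ring

/-! ## §3 `MKer` form: the pure-gauge vertex of a `Πᵀ_bm`-dressed stencil family -/

/-- [folklore] `AxialProjector.cod` is `AffineAveraging.codiff₁`. -/
theorem cod_eq_codiff₁ (g : Form1 (d + 1) ℝ) (p : Fin (d + 1) → ℤ) : AxialProjector.cod g p = codiff₁ g p := rfl

/-- [folklore] **THE PURE-GAUGE VERTEX OF A `Πᵀ_bm`-DRESSED STENCIL FAMILY IS THE BLOCK AVERAGE** (in-block root `r`, `1 ≤ N`, packed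
fibre): `KernelWard.divV (coProjBmAtK (toSite r) N S) u = (N^{d+1})⁻¹ • Σ_{b ∈ box} KernelWard.divV S (N•blk N u + b)` at EVERY fine site `u` —
root-free, no base-point condition (contrast `CoProjDivergence.divV_coProj` for the corner comb: supported on base points). -/
theorem divV_coProjBmAtK {N : ℕ} (hN : 1 ≤ N) {r : Fin (d + 1) → ℕ} (hr : r ∈ box (d + 1) N)
    (S : Fin (d + 1) → (Fin (d + 1) → ℤ) → ExpKernelCalculus.MKer (d + 1) (OneStepResolventKernel.Fib d)) (u : Fin (d + 1) → ℤ) :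
    KernelWard.divV (coProjBmAtK (toSite r) N S) u
      = (((N : ℝ) ^ (d + 1))⁻¹) • ∑ b ∈ box (d + 1) N, KernelWard.divV S ((N : ℤ) • blk N u + toSite b) := by
  funext x z a c
  rw [CoProjDivergence.divV_apply_eq_cod, cod_eq_codiff₁]
  have e : (fun κ' u' => coProjBmAtK (toSite r) N S κ' u' x z a c) = coProjBmAt (toSite r) N (fun κ' u' => S κ' u' x z a c) := by
    funext κ' u'; exact coProjBmAtK_eval (toSite r) N S κ' u' x z a c
  rw [e, codiff₁_coProjBmAt hN hr]
  simp only [Pi.smul_apply, Finset.sum_apply, smul_eq_mul, CoProjDivergence.divV_apply_eq_cod, cod_eq_codiff₁]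

/-- [folklore] The same for a bi-table dressed by `Πᵀ_bm` in its FIRST bond slot. -/
theorem divW_coProjBmAtK_fst {N : ℕ} (hN : 1 ≤ N) {r : Fin (d + 1) → ℕ} (hr : r ∈ box (d + 1) N)
    (Wf : Fin (d + 1) → (Fin (d + 1) → ℤ) → Fin (d + 1) → (Fin (d + 1) → ℤ) → ExpKernelCalculus.MKer (d + 1) (OneStepResolventKernel.Fib d))
    (u : Fin (d + 1) → ℤ) (ν : Fin (d + 1)) (u' : Fin (d + 1) → ℤ) :
    KernelWard.divW (fun κ x ν' x' => coProjBmAtK (toSite r) N (fun κ' z => Wf κ' z ν' x') κ x) u ν u'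
      = (((N : ℝ) ^ (d + 1))⁻¹) • ∑ b ∈ box (d + 1) N, KernelWard.divW Wf ((N : ℤ) • blk N u + toSite b) ν u' := by
  rw [CoProjDivergence.divW_eq_divV_fst]
  show KernelWard.divV (coProjBmAtK (toSite r) N (fun κ' z => Wf κ' z ν u')) u = _
  rw [divV_coProjBmAtK hN hr]
  rfl

/-! ## §4 (W1′) for the `Πᵀ_bm`-dressed stencil and the Ward rows of `fineHessA A (coProjBmAtK ρ n S) Wf` from LETTERS -/

section Letters

open ExpKernelCalculus (Site MKer Decays BiLoc comp tadpole)
open KernelWard (divV divW)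
open B6BondElimination (unitVec)
open OneStepResolventKernel (Fib LocStencil)
open Summit.QuantumFields.BalabanUV.Beta.TameKernelCalculus
open Summit.QuantumFields.BalabanUV.Beta.ChartConjugation (conjV conjW)
open Summit.QuantumFields.BalabanUV.Beta.ChartConjugationRelative (RelInv)
open Summit.QuantumFields.BalabanUV.Beta.AxialDressingRooted (locStencil_coProjBmAtK cKb')
open Summit.QuantumFields.BalabanUV.Beta.D1BFx.ReducedKernelSandwichLeg (fineHessA)
open Summit.QuantumFields.BalabanUV.Beta.D1BFx.FineHessianWardRelative (divFree_fineHessA_of_relWard hasSum_row_fineHessA_of_relWard conjV_smul)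

/-- [folklore] **(W1′) FOR THE `Πᵀ_bm`-DRESSED STENCIL AT EVERY FINE SITE** from the BLOCK-STENCIL WARD LAW
`cH • Σ_{v∈box} divV S (N•y + v) = conjV 𝕄 (Xc y)` (an1's `hSd`; leaf-10's `WardLocusRecursive.hSd_SrecAt` shape), `cH ≠ 0`:
`divV (coProjBmAtK (toSite r) N S) u = conjV 𝕄 (((N^{d+1})⁻¹·cH⁻¹) • Xc (blk N u))` — a BLOCK-CONSTANT generator, no base-point condition. -/
theorem divV_coProjBmAtK_eq_conjV {N : ℕ} (hN : 1 ≤ N) {r : Fin (d + 1) → ℕ} (hr : r ∈ box (d + 1) N)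
    {S : Fin (d + 1) → (Fin (d + 1) → ℤ) → MKer (d + 1) (Fib d)} {M : MKer (d + 1) (Fib d)} {Xc : (Fin (d + 1) → ℤ) → MKer (d + 1) (Fib d)}
    {cH : ℝ} (hcH : cH ≠ 0) (hSd : ∀ y : Fin (d + 1) → ℤ, cH • ∑ v ∈ box (d + 1) N, divV S ((N : ℤ) • y + toSite v) = conjV M (Xc y))
    (u : Fin (d + 1) → ℤ) :
    divV (coProjBmAtK (toSite r) N S) u = conjV M (((((N : ℝ) ^ (d + 1))⁻¹) * cH⁻¹) • Xc (blk N u)) := by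
  rw [divV_coProjBmAtK hN hr, conjV_smul, mul_smul, ← hSd (blk N u), smul_smul cH⁻¹, inv_mul_cancel₀ hcH, one_smul]

variable {A M E : MKer (3 + 1) (Fib 3)} {n : ℕ} {r : Fin (3 + 1) → ℕ}
  {S : Fin (3 + 1) → (Fin (3 + 1) → ℤ) → MKer (3 + 1) (Fib 3)} {Cs δs : ℝ}
  {Wf : Fin (3 + 1) → (Fin (3 + 1) → ℤ) → Fin (3 + 1) → (Fin (3 + 1) → ℤ) → MKer (3 + 1) (Fib 3)} {C2 δ2 : ℝ}
  {Xc : (Fin (3 + 1) → ℤ) → MKer (3 + 1) (Fib 3)} {cH : ℝ}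
  {X₂ Nr : (Fin (3 + 1) → ℤ) → Fin (3 + 1) → (Fin (3 + 1) → ℤ) → MKer (3 + 1) (Fib 3)}

/-- [folklore] **FIRST-BOND TRANSVERSALITY OF THE `Πᵀ_bm`-DRESSED FINE HESSIAN KERNEL FROM LETTERS** (`d + 1 = 4`, `Fib 3`, in-block root
`r`, `1 ≤ n`): the Bm twin of `FineHessianWardRelative.divFree_fineHessA_coProj_of_letters` — same letters {`RelInv A 𝕄 E`, block-stencil
Ward law, (W2♮)}, but the generator is the BLOCK-CONSTANT `X′ u := ((n^{d+1})⁻¹·cH⁻¹) • Xc (blk n u)` at EVERY fine site (no `if`). -/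
theorem divFree_fineHessA_coProjBmAtK_of_letters (hn : 1 ≤ n) (hr : r ∈ box (3 + 1) n) (hA : Spr A) (hM : Spr M) (hE : Spr E)
    (hR : RelInv A M E) (hS : LocStencil S Cs δs) (hδs : 0 < δs) (hW : ∀ κ' u l' u', BiLoc (Wf κ' u l' u') u u' C2 δ2) (hδ2 : 0 < δ2)
    (hcH : cH ≠ 0) (hXc : ∀ y, Loc (Xc y)) (hEXc : ∀ y, comp E (Xc y) = comp (Xc y) E)
    (hSd : ∀ y : Fin (3 + 1) → ℤ, cH • ∑ v ∈ box (3 + 1) n, divV S ((n : ℤ) • y + toSite v) = conjV M (Xc y))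
    (hX₂ : ∀ u ν u', Loc (X₂ u ν u')) (hEX₂ : ∀ u ν u', comp E (X₂ u ν u') = comp (X₂ u ν u') E)
    (hNr : ∀ u ν u', Loc (Nr u ν u')) (hN0 : ∀ u ν u', tadpole A (Nr u ν u') = 0)
    (hWd : ∀ u ν u', divW Wf u ν u' = conjW M 0 (coProjBmAtK (toSite r) n S ν u')
      (((((n : ℝ) ^ (3 + 1))⁻¹) * cH⁻¹) • Xc (blk n u)) 0 (X₂ u ν u') + Nr u ν u')
    (l' : Fin (3 + 1)) (u' u : Fin (3 + 1) → ℤ) :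
    ∑ κ' : Fin (3 + 1), (fineHessA A (coProjBmAtK (toSite r) n S) Wf κ' l' (u - unitVec κ') u'
      - fineHessA A (coProjBmAtK (toSite r) n S) Wf κ' l' u u') = 0 := by
  have hm : 0 < min δs δ2 := lt_min hδs hδ2
  have hS' : ∀ κ u, BiLoc (coProjBmAtK (toSite r) n S κ u) u u (|cKb' 3 n δs * Cs|) (min δs δ2) := fun κ u =>
    biLoc_of_le (locStencil_coProjBmAtK hn hr hS hδs.le κ u) (min_le_left _ _)
  have hW' : ∀ κ' u l' u', BiLoc (Wf κ' u l' u') u u' (|C2|) (min δs δ2) := fun κ' u l' u' =>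
    biLoc_of_le (hW κ' u l' u') (min_le_right _ _)
  exact divFree_fineHessA_of_relWard hA hM hE hR hS' hW' hm (fun u => (hXc (blk n u)).smul _) hX₂ hNr
    (fun u => by rw [KernelReflection.comp_smul_right, KernelReflection.comp_smul_left, hEXc]) hEX₂
    (fun u => divV_coProjBmAtK_eq_conjV hn hr hcH hSd u) hWd hN0 l' u' u

/-- [folklore] **THE WARD ROWS `hrow` OF THE `Πᵀ_bm`-DRESSED FINE HESSIAN KERNEL FROM LETTERS** (symmetric table): the Bm twin of
`FineHessianWardRelative.hasSum_row_fineHessA_coProj_of_letters`. -/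
theorem hasSum_row_fineHessA_coProjBmAtK_of_letters (hn : 1 ≤ n) (hr : r ∈ box (3 + 1) n) (hA : Spr A) (hM : Spr M) (hE : Spr E)
    (hR : RelInv A M E) (hS : LocStencil S Cs δs) (hδs : 0 < δs) (hW : ∀ κ' u l' u', BiLoc (Wf κ' u l' u') u u' C2 δ2) (hδ2 : 0 < δ2)
    (hWsymm : ∀ (κ' : Fin 4) (u : Fin (3 + 1) → ℤ) (l' : Fin 4) (u' : Fin (3 + 1) → ℤ), Wf κ' u l' u' = Wf l' u' κ' u)
    (hcH : cH ≠ 0) (hXc : ∀ y, Loc (Xc y)) (hEXc : ∀ y, comp E (Xc y) = comp (Xc y) E)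
    (hSd : ∀ y : Fin (3 + 1) → ℤ, cH • ∑ v ∈ box (3 + 1) n, divV S ((n : ℤ) • y + toSite v) = conjV M (Xc y))
    (hX₂ : ∀ u ν u', Loc (X₂ u ν u')) (hEX₂ : ∀ u ν u', comp E (X₂ u ν u') = comp (X₂ u ν u') E)
    (hNr : ∀ u ν u', Loc (Nr u ν u')) (hN0 : ∀ u ν u', tadpole A (Nr u ν u') = 0)
    (hWd : ∀ u ν u', divW Wf u ν u' = conjW M 0 (coProjBmAtK (toSite r) n S ν u')
      (((((n : ℝ) ^ (3 + 1))⁻¹) * cH⁻¹) • Xc (blk n u)) 0 (X₂ u ν u') + Nr u ν u')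
    (κ' l' : Fin (3 + 1)) (b : Fin (3 + 1) → ℤ) :
    HasSum (fineHessA A (coProjBmAtK (toSite r) n S) Wf κ' l' b) 0 := by
  have hm : 0 < min δs δ2 := lt_min hδs hδ2
  have hS' : ∀ κ u, BiLoc (coProjBmAtK (toSite r) n S κ u) u u (|cKb' 3 n δs * Cs|) (min δs δ2) := fun κ u =>
    biLoc_of_le (locStencil_coProjBmAtK hn hr hS hδs.le κ u) (min_le_left _ _)
  have hW' : ∀ κ' u l' u', BiLoc (Wf κ' u l' u') u u' (|C2|) (min δs δ2) := fun κ' u l' u' =>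
    biLoc_of_le (hW κ' u l' u') (min_le_right _ _)
  exact hasSum_row_fineHessA_of_relWard hA hM hE hR hS' hW' hm hWsymm (fun u => (hXc (blk n u)).smul _) hX₂ hNr
    (fun u => by rw [KernelReflection.comp_smul_right, KernelReflection.comp_smul_left, hEXc]) hEX₂
    (fun u => divV_coProjBmAtK_eq_conjV hn hr hcH hSd u) hWd hN0 κ' l' b

end Letters

end Summit.QuantumFields.BalabanUV.Beta.D1BFx.CoProjBmDivergence

end
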